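import Mathlib
import HarnessLib
import Summits.NavierStokesRegularity.NavierStokesRegularity.Theorems.TaylorModelRungThreeCertificateBoxFieldDLin
import Summits.NavierStokesRegularity.NavierStokesRegularity.Theorems.TaylorModelRungThreeCertificateIntervalDPoly
import Summits.NavierStokesRegularity.NavierStokesRegularity.Theorems.TaylorModelRungThreeCertificateIntervalDMatrix
import Summits.NavierStokesRegularity.NavierStokesRegularity.Theorems.TaylorModelRungThreeVDefs

/-!
# Crux K1b-DR (stmt-NavierStokesRegularity-23954), line `taylor-model` — the SIGNED ONE-STEP DERIVATIVE ENCLOSURE `[M_s]` as an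
# interval matrix (clause (M) of `ChainVCore`, `…TaylorModelRungThreeVDefs`; PROPAGATE-V-SPEC-cert1 §2 C) — engine-1 g67's request

`T.stepMatrixM coefB prec Y pV Hh S Winv : Array (Array IntervalD)` (row `r = idx i' k'` × column `c = idx i k`, read by engine-1's `imget`)
is computed as: state levels `Ls := jetLevelsA n (qBboxMA …) prec Y pV` over the start hull `Y = H²`; the shared linearised tables
`opsOf (linSym …) Ls pV`; per basis column `c` the variational levels `wColLevelsA … (basisBoxA n c) pV` and their Horner value at `Hh ∋ h`
(`polyLevelsA`); entry `(r, c) := poly ⊕ (S[r] · Winv[c]) · [−1, 1]` with `S[r] ∋ JU_(i',k') · h^(pV+1)` and `Winv[c] ∋ (ω k)⁻¹` supplied by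
the caller (row/column data of the sub-step). MAIN THEOREM `stepMatrixM_spec` — VERBATIM the (M) clause shape: for every `z` with window
coordinates in `Y` and all window pairs,
`(imget M (idx i' k') (idx i k)).lo ≤ Σ_{n≤pV} varJet d.Qb z (basisSt i k) n i' k' · h^n − JU i' k' · (ω k)⁻¹ · h^(pV+1)` and
`Σ … + JU i' k' · (ω k)⁻¹ · h^(pV+1) ≤ (imget M (idx i' k') (idx i k)).hi`. Tools: `basisBoxA` (+ `mem_basisSt_basisBoxA`), `pmOne`,
generic `stepMatA` with `stepMatA_spec`.

MODEL-lattice bookkeeping only (rung TL-M3); nothing here concerns the Navier–Stokes equations.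
-/

-- the sub-problem namespace repeats the summit name by design (D-0017)
set_option linter.dupNamespace false

namespace Summit.NavierStokesRegularity.NavierStokesRegularity.Theorems.TaylorModelCert

open scoped BigOperators
open Literature.Analysis.FluidPDE.TaoCascade Literature.Analysis.FluidPDE.TaoCascade.TaylorChain
open Summit.NavierStokesRegularity.NavierStokesRegularity.Theorems.TaylorModelReadout (varJet)
open Summit.NavierStokesRegularity.NavierStokesRegularity.Theorems.TaylorModelV (basisSt)

namespace IntervalD

/-- The point box of the `col`-th basis vector (size `n`). [folklore] -/
def basisBoxA (n col : ℕ) : Array IntervalD := Array.ofFn fun c : Fin n => if c.val = col then ofInt 1 else ofInt 0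

/-- `basisBoxA` has size `n`. [folklore] -/
theorem size_basisBoxA (n col : ℕ) : (basisBoxA n col).size = n := by simp only [basisBoxA, Array.size_ofFn]

/-- Reader of `basisBoxA`. [folklore] -/
theorem aget_basisBoxA (n col : ℕ) {c : ℕ} (hc : c < n) : aget (basisBoxA n col) c = if c = col then ofInt 1 else ofInt 0 := by
  unfold basisBoxA; rw [aget_ofFn _ hc]

/-- The interval `[−1, 1]`. [folklore] -/
def pmOne : IntervalD := ⟨⟨-1, 0⟩, ⟨1, 0⟩⟩

/-- `1 ∈ [−1, 1]`. [folklore] -/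
theorem mem_pmOne_one : mem (1 : ℝ) pmOne := by simp [mem, pmOne, Dyad.toReal]

/-- `−1 ∈ [−1, 1]`. [folklore] -/
theorem mem_pmOne_neg_one : mem (-1 : ℝ) pmOne := by simp [mem, pmOne, Dyad.toReal]

/-- **Assembly of a signed enclosure matrix** (row-major `n × n`): entry `(r, c) := cols[c][r] ⊕ (S[r]·Winv[c])·[−1,1]`. [folklore] -/
def stepMatA (n prec : ℕ) (cols : Array (Array IntervalD)) (S Winv : Array IntervalD) : Array (Array IntervalD) :=
  Array.ofFn fun r : Fin n => Array.ofFn fun c : Fin n =>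
    addR prec (aget (lget cols c) r) (mulR prec (mulR prec (aget S r) (aget Winv c)) pmOne)

/-- **The assembled matrix bounds `poly ± s·w`**: if `p ∈ cols[c][r]`, `s ∈ S[r]`, `w ∈ Winv[c]` then
`(M r c).lo ≤ p − s·w` and `p + s·w ≤ (M r c).hi`. [folklore] -/
theorem stepMatA_spec {n : ℕ} (prec : ℕ) {cols : Array (Array IntervalD)} {S Winv : Array IntervalD} {r c : ℕ} (hr : r < n) (hc : c < n)
    {p s w : ℝ} (hp : mem p (aget (lget cols c) r)) (hs : mem s (aget S r)) (hw : mem w (aget Winv c)) :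
    (imget (stepMatA n prec cols S Winv) r c).lo.toReal ≤ p - s * w ∧ p + s * w ≤ (imget (stepMatA n prec cols S Winv) r c).hi.toReal := by
  have hsw := mem_mulR prec hs hw
  have hplus : mem (p + s * w) (imget (stepMatA n prec cols S Winv) r c) := by
    unfold stepMatA; rw [imget_ofFn_row _ c hr, aget_ofFn _ hc]
    simpa using mem_addR prec hp (mem_mulR prec hsw mem_pmOne_one)
  have hminus : mem (p - s * w) (imget (stepMatA n prec cols S Winv) r c) := by
    unfold stepMatA; rw [imget_ofFn_row _ c hr, aget_ofFn _ hc]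
    simpa [sub_eq_add_neg] using mem_addR prec hp (mem_mulR prec hsw mem_pmOne_neg_one)
  exact ⟨hminus.1, hplus.2⟩

end IntervalD

namespace CertTables

section Defs

variable {K : Type} [Field K] [LinearOrder K]

/-- **The (M) matrix of a sub-step** (signed one-step derivative enclosure, row `idx i' k'` × column `idx i k`): state levels over the
start hull box `Y`, shared linearised tables, variational levels of every basis column to order `pV`, Horner value at `Hh ∋ h`, plus the
remainder `S[r]·Winv[c]·[−1,1]` (`S[r] ∋ JU·h^(pV+1)`, `Winv[c] ∋ ω⁻¹`). [folklore] -/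
def stepMatrixM (T : CertTables K) (coefB : Fin 4 → Fin 4 → Fin 4 → ℕ → ℤ → IntervalD) (prec : ℕ) (Y : Array IntervalD) (pV : ℕ)
    (Hh : IntervalD) (S Winv : Array IntervalD) : Array (Array IntervalD) :=
  let mt := T.monosTable coefB
  let Ls := IntervalD.jetLevelsA T.n (T.qBboxMA coefB prec mt) prec Y pV
  let ops := IntervalD.opsOf (T.linSym coefB prec mt) Ls pV
  let cols : Array (Array IntervalD) := Array.ofFn fun col : Fin T.n =>
    IntervalD.polyLevelsA T.n prec (IntervalD.wColLevelsA T.n prec ops (IntervalD.basisBoxA T.n col) pV) pV Hh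
  IntervalD.stepMatA T.n prec cols S Winv

end Defs

section Sound

variable {K : Type} [Field K] {φ : K →+* ℝ} (T : CertTables K) {coefB : Fin 4 → Fin 4 → Fin 4 → ℕ → ℤ → IntervalD}

omit [Field K] in
/-- The window basis state `basisSt i k` lies in the point box `basisBoxA n (idx i k)` (window coordinates). [folklore] -/
theorem mem_basisSt_basisBoxA (i : Fin 4) {k : ℤ} (hk : -T.Kb ≤ k ∧ k ≤ T.Ka) :
    ∀ c < T.n, IntervalD.mem (T.wv (basisSt i k) c) (IntervalD.aget (IntervalD.basisBoxA T.n (T.idx i k)) c) := by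
  intro c hc
  rw [IntervalD.aget_basisBoxA _ _ hc]
  unfold wv basisSt
  by_cases h : c = T.idx i k
  · have h1 : T.wi c = i := by rw [h, T.wi_idx i hk]
    have h2 : T.wk c = k := by rw [h, T.wk_idx i hk]
    rw [if_pos ⟨h1, h2⟩, if_pos h]
    simpa using IntervalD.mem_ofInt 1
  · have hne : ¬(T.wi c = i ∧ T.wk c = k) := by
      rintro ⟨h1, h2⟩
      exact h (by rw [← h1, ← h2, T.idx_wi_wk hc])
    rw [if_neg hne, if_neg h]
    simpa using IntervalD.mem_ofInt 0

/-- **The (M) matrix satisfies clause (M) of `ChainVCore`** (VDefs p620175 shape): for every shell state `z` with window coordinates in `Y`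
(the outer start hull), `h ∈ Hh`, row data `JU i' k' · h^(pV+1) ∈ S[idx i' k']` and column data `(ω k)⁻¹ ∈ Winv[idx i k]`, at all window
pairs `(i,k)` (column) and `(i',k')` (row):
`(imget M (idx i' k') (idx i k)).lo ≤ Σ_{n≤pV} varJet d.Qb z (basisSt i k) n i' k' · h^n − JU i' k' · (ω k)⁻¹ · h^(pV+1)` and the
symmetric upper bound. [folklore] -/
theorem stepMatrixM_spec (hco : T.CoefOK φ) (hcB : CoefBoxOK φ T coefB) (prec pV : ℕ) {Y : Array IntervalD} (hY : Y.size = T.n)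
    {z : Fin 4 → ℤ → ℝ} (hz : ∀ c < T.n, IntervalD.mem (T.wv z c) (IntervalD.aget Y c))
    {h : ℝ} {Hh : IntervalD} (hH : IntervalD.mem h Hh)
    {JU : Fin 4 → ℤ → ℝ} {S : Array IntervalD}
    (hS : ∀ i' k', -T.Kb ≤ k' → k' ≤ T.Ka → IntervalD.mem (JU i' k' * h ^ (pV + 1)) (IntervalD.aget S (T.idx i' k')))
    {ω : ℤ → ℝ} {Winv : Array IntervalD} (hW : ∀ i k, -T.Kb ≤ k → k ≤ T.Ka → IntervalD.mem ((ω k)⁻¹) (IntervalD.aget Winv (T.idx i k)))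
    (i : Fin 4) {k : ℤ} (hk1 : -T.Kb ≤ k) (hk2 : k ≤ T.Ka) (i' : Fin 4) {k' : ℤ} (hk1' : -T.Kb ≤ k') (hk2' : k' ≤ T.Ka) :
    (imget (T.stepMatrixM coefB prec Y pV Hh S Winv) (T.idx i' k') (T.idx i k)).lo.toReal ≤
        (∑ n ∈ Finset.range (pV + 1), varJet (T.toCertData φ).Qb z (basisSt i k) n i' k' * h ^ n) - JU i' k' * (ω k)⁻¹ * h ^ (pV + 1) ∧
      (∑ n ∈ Finset.range (pV + 1), varJet (T.toCertData φ).Qb z (basisSt i k) n i' k' * h ^ n) + JU i' k' * (ω k)⁻¹ * h ^ (pV + 1) ≤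
        (imget (T.stepMatrixM coefB prec Y pV Hh S Winv) (T.idx i' k') (T.idx i k)).hi.toReal := by
  have hr : T.idx i' k' < T.n := T.idx_lt_n i' ⟨hk1', hk2'⟩
  have hc : T.idx i k < T.n := T.idx_lt_n i ⟨hk1, hk2⟩
  -- the column levels enclose the variational jets of the basis direction, and Horner encloses their polynomial
  have hcol : IntervalD.mem (∑ n ∈ Finset.range (pV + 1), varJet (T.toCertData φ).Qb z (basisSt i k) n i' k' * h ^ n)
      (IntervalD.aget (IntervalD.lget (Array.ofFn fun col : Fin T.n => IntervalD.polyLevelsA T.n prec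
        (IntervalD.wColLevelsA T.n prec (IntervalD.opsOf (T.linSym coefB prec (T.monosTable coefB))
          (IntervalD.jetLevelsA T.n (T.qBboxMA coefB prec (T.monosTable coefB)) prec Y pV) pV) (IntervalD.basisBoxA T.n col) pV) pV Hh)
        (T.idx i k)) (T.idx i' k')) := by
    rw [IntervalD.lget_ofFn _ hc]
    have hmv := T.mem_varJet_of_wColLevelsA_lin hco hcB prec pV hY (IntervalD.size_basisBoxA T.n (T.idx i k)) hz
      (T.mem_basisSt_basisBoxA i ⟨hk1, hk2⟩)
    have hpoly := IntervalD.mem_polyLevelsA prec (a := fun n c => T.wv (varJet (T.toCertData φ).Qb z (basisSt i k) n) c)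
      (fun n hn c hc' => hmv n hn c hc') hH (T.idx i' k') hr
    simpa only [T.wv_idx _ i' ⟨hk1', hk2'⟩] using hpoly
  have hM := IntervalD.stepMatA_spec prec hr hc hcol (hS i' k' hk1' hk2') (hW i k hk1 hk2)
  rw [mul_right_comm (JU i' k') (h ^ (pV + 1)) ((ω k)⁻¹)] at hM
  simpa only [stepMatrixM] using hM

end Sound

end CertTables

end Summit.NavierStokesRegularity.NavierStokesRegularity.Theorems.TaylorModelCert
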